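import Summits.CriticalPhenomena.SAWScalingLimit.Theorems.SAWDevelopingMapObservableToSLETypeLadderCarvedReductionSqueezeArcReplace
import HarnessLib

/-!
# The WINDOW FRAME: replacing the lowered diameter of a window cross-cut by a rectangular frame
# hanging from the gate line (piece (T-A′ frame-b) of stub T-A′
# `stub_carvedReduction_squeezeGeometry_domains`)

Crux `SAWDevelopingMap.ObservableToSLE` (stmt-CriticalPhenomena-10472), line `six-class-type-ladder`,
stub T-A′ `stub_carvedReduction_squeezeGeometry_domains`.  Landing target:
`Summits/CriticalPhenomena/SAWScalingLimit/Theorems/SAWDevelopingMapObservableToSLETypeLadderCarvedReductionSqueezeWindowFrame.lean`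
(`--supports stmt-CriticalPhenomena-10472`; registered carrier `stub_carvedReduction_windowFrame`).
Sequel of `…SqueezeArcReplace` (`crosscut_replace`).

WHY.  The reach clause (R) of STAGE 2 (`carvedReduction_squeezeGeometry_lattice`, p137080) forces
the outer domain `E` to contain, eventually, the closed `25 s_j`-discs about every present pinned
vertex up to the slabs `{|re - re P_i| ≤ ρc, im P_i - 30 s_j ≤ im ≤ im P_i}`; present vertices hug
the gate line `im = im P_i` from above along the whole window, so `E` must contain the thin strips
just below the line OUTSIDE `|re - re P_i| ≤ ρc`, while the closed gate box
`[re P_i ± ρc] × [im P_i - ρc', im P_i]` must lie in `Eᶜ`.  Hence near the gate the cut of the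
super-domain must be EXACTLY the gate segment `[P_i - ρc, P_i + ρc]` plus two vertical sides going
DOWN from its ends to depth `ρc' = h`, and nothing else of the cut may return near the line.  The
twin's `Squeeze.stub_carvedReduction_legsToCrosscut` (p135598) gives no control of the legs near the
dock tops (a leg may leave `P_i ± ρ` tangentially just below the line), so it is applied to a LOWERED
window (centre `P_i - h i`, radius `ρ'`, corridor below depth `h`) and the lowered diameter is then
replaced by the three-sided frame:

* `frame_subset_rect`, `isSimpleArc_frame`, `frame_inter_closedBall` — the frame
  `[g - ρ' - h i, g - ρ'] ∪ [g - ρ', g + ρ'] ∪ [g + ρ', g + ρ' - h i]` is a simple arc inside the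
  closed rectangle `R = [re g ± ρ'] × [im g - h, im g]` meeting `closedBall g ρw` (`ρw < ρ'`)
  exactly in the gate segment `[g - ρw, g + ρw]`;
* `stub_carvedReduction_windowFrame` — from a cross-cut `L'` of `J` through the lowered diameter,
  otherwise inside a set `O` missing `R` and the closed gate ball: a cross-cut `L` through the
  frame with `F ⊆ L ⊆ O ∪ F ∪ {x 0, x 1}`, `L ∩ R = F`, `L ∩ closedBall g ρw = [g - ρw, g + ρw]`
  (the input of `Squeeze.stub_carvedReduction_superDomainOfCrosscuts`, p133663, at radius `ρw`);
* `superDomain_box_subset_compl` — for the super-domain `E ⊆ J ∖ C` so cut (open, flat at `g` at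
  radius `ρw`, `frontier E ⊆ C ∪ ∂J`, `C ∩ R = frame`), the closed rectangle lies in `Eᶜ`:
  clause (hB) of STAGE 2 with `ρc := ρ'`, `ρc' := h`.

Sources: M. H. A. Newman, Elements of the topology of plane sets of points (1939), Ch. III §1,
Ch. V §11.
-/

noncomputable section
open scoped Topology
open Filter Set Metric
open Literature.Probability.RandomPlanarGeometry
open Literature.Topology.PlaneTopology

namespace Summit.CriticalPhenomena.SAWScalingLimit.Theorems.ObservableToSLE.TypeLadder

/-! ### The frame -/

section Frame

variable {g : ℂ} {ρ' h ρw : ℝ}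

/-- The three-sided frame `[g - ρ' - h i, g - ρ'] ∪ [g - ρ', g + ρ'] ∪ [g + ρ', g + ρ' - h i]`
lies in the closed rectangle `[re g ± ρ'] × [im g - h, im g]`. -/
theorem frame_subset_rect (hρ' : 0 < ρ') (hh : 0 < h) :
    segment ℝ (g - ρ' - h * Complex.I) (g - ρ') ∪ segment ℝ (g - ρ') (g + ρ') ∪
        segment ℝ (g + ρ') (g + ρ' - h * Complex.I) ⊆
      {z : ℂ | |z.re - g.re| ≤ ρ' ∧ g.im - h ≤ z.im ∧ z.im ≤ g.im} := by
  rintro z ((hz | hz) | hz)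
  · rw [segment_symm] at hz
    obtain ⟨hre, h1, h2⟩ := (mem_vSegment_iff hh).1 hz
    simp only [Complex.sub_re, Complex.ofReal_re, Complex.sub_im, Complex.ofReal_im, sub_zero] at hre h1 h2
    exact ⟨by rw [hre, show g.re - ρ' - g.re = -ρ' by ring, abs_neg, abs_of_pos hρ'], h1, h2⟩
  · obtain ⟨him, hre⟩ := (mem_hSegment_iff hρ').1 hz
    exact ⟨hre, by rw [him]; linarith, him.le⟩
  · obtain ⟨hre, h1, h2⟩ := (mem_vSegment_iff hh).1 hz
    simp only [Complex.add_re, Complex.ofReal_re, Complex.add_im, Complex.ofReal_im, add_zero] at hre h1 h2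
    exact ⟨by rw [hre, show g.re + ρ' - g.re = ρ' by ring, abs_of_pos hρ'], h1, h2⟩

/-- The frame is a simple arc from its lower-left to its lower-right corner. -/
theorem isSimpleArc_frame (hρ' : 0 < ρ') (hh : 0 < h) :
    IsSimpleArc (segment ℝ (g - ρ' - h * Complex.I) (g - ρ') ∪ segment ℝ (g - ρ') (g + ρ') ∪
        segment ℝ (g + ρ') (g + ρ' - h * Complex.I))
      (g - ρ' - h * Complex.I) (g + ρ' - h * Complex.I) := by
  have hhI : (h : ℂ) * Complex.I ≠ 0 :=
    mul_ne_zero (Complex.ofReal_ne_zero.2 hh.ne') Complex.I_ne_zero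
  have h1 : IsSimpleArc (segment ℝ (g - ρ' - h * Complex.I) (g - ρ')) (g - ρ' - h * Complex.I) (g - ρ') :=
    IsSimpleArc.segment fun heq => hhI (by linear_combination (-1 : ℂ) * heq)
  have h2 : IsSimpleArc (segment ℝ (g - ρ') (g + ρ')) (g - ρ') (g + ρ') :=
    IsSimpleArc.segment fun heq => hρ'.ne' (by
      have := congrArg Complex.re heq
      simp at this
      linarith)
  have h3 : IsSimpleArc (segment ℝ (g + ρ') (g + ρ' - h * Complex.I)) (g + ρ') (g + ρ' - h * Complex.I) :=
    IsSimpleArc.segment fun heq => hhI (by linear_combination heq)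
  refine (h1.union h2 ?_).union h3 ?_
  · rintro z ⟨hz1, hz2⟩
    rw [segment_symm] at hz1
    obtain ⟨hre, -, -⟩ := (mem_vSegment_iff hh).1 hz1
    obtain ⟨him, -⟩ := (mem_hSegment_iff hρ').1 hz2
    rw [mem_singleton_iff]
    apply Complex.ext
    · rw [hre]
    · rw [him]; simp
  · rintro z ⟨hz12 | hz12, hz3⟩
    · rw [segment_symm] at hz12
      obtain ⟨hre, -, -⟩ := (mem_vSegment_iff hh).1 hz12
      obtain ⟨hre', -, -⟩ := (mem_vSegment_iff hh).1 hz3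
      rw [hre'] at hre
      simp at hre
      linarith
    · obtain ⟨him, -⟩ := (mem_hSegment_iff hρ').1 hz12
      obtain ⟨hre, -, -⟩ := (mem_vSegment_iff hh).1 hz3
      rw [mem_singleton_iff]
      apply Complex.ext
      · rw [hre]
      · rw [him]; simp

/-- The frame meets the closed gate ball `closedBall g ρw`, `ρw < ρ'`, exactly in the gate
segment `[g - ρw, g + ρw]`. -/
theorem frame_inter_closedBall (hρw : 0 < ρw) (hρ' : ρw < ρ') (hh : 0 < h) :
    (segment ℝ (g - ρ' - h * Complex.I) (g - ρ') ∪ segment ℝ (g - ρ') (g + ρ') ∪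
        segment ℝ (g + ρ') (g + ρ' - h * Complex.I)) ∩ closedBall g ρw =
      segment ℝ (g - ρw) (g + ρw) := by
  have hρ'0 : 0 < ρ' := hρw.trans hρ'
  have hrele : ∀ z : ℂ, |z.re - g.re| ≤ dist z g := fun z => by
    rw [dist_eq_norm, ← Complex.sub_re]; exact Complex.abs_re_le_norm _
  apply Subset.antisymm
  · rintro z ⟨(hz | hz) | hz, hzb⟩
    · exfalso
      rw [segment_symm] at hz
      obtain ⟨hre, -, -⟩ := (mem_vSegment_iff hh).1 hz
      have h1 := hrele z
      rw [mem_closedBall] at hzb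
      rw [hre] at h1
      simp [abs_of_pos hρ'0] at h1
      linarith
    · obtain ⟨him, -⟩ := (mem_hSegment_iff hρ'0).1 hz
      exact (mem_hSegment_iff hρw).2 ⟨him, (hrele z).trans (mem_closedBall.1 hzb)⟩
    · exfalso
      obtain ⟨hre, -, -⟩ := (mem_vSegment_iff hh).1 hz
      have h1 := hrele z
      rw [mem_closedBall] at hzb
      rw [hre] at h1
      simp [abs_of_pos hρ'0] at h1
      linarith
  · intro z hz
    obtain ⟨him, hre⟩ := (mem_hSegment_iff hρw).1 hz
    refine ⟨Or.inl (Or.inr ((mem_hSegment_iff hρ'0).2 ⟨him, hre.trans hρ'.le⟩)), ?_⟩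
    rw [mem_closedBall, dist_eq_norm]
    have : z - g = ((z.re - g.re : ℝ) : ℂ) := by
      apply Complex.ext <;> simp [him]
    rw [this, Complex.norm_real, Real.norm_eq_abs]
    exact hre

end Frame

/-! ### The window frame cross-cut -/

/-- **Registered carrier `stub_carvedReduction_windowFrame`** (crux item stmt-CriticalPhenomena-10472,
stub T-A′ `stub_carvedReduction_squeezeGeometry_domains`, piece WINDOW FRAME).  Let `J` be a Jordan
domain, `g` a gate, `0 < ρw < ρ'`, `0 < h`, the closed rectangle
`R = [re g ± ρ'] × [im g - h, im g]` and the closed gate ball `closedBall g ρw` inside `J`, `O` a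
set missing both, and `L'` a cross-cut of `J` from `x 0` to `x 1` through the lowered diameter
`[g - ρ' - h i, g + ρ' - h i]` and otherwise inside `O ∪ {x 0, x 1}`.  Then, replacing the lowered
diameter by the frame `F = [g - ρ' - h i, g - ρ'] ∪ [g - ρ', g + ρ'] ∪ [g + ρ', g + ρ' - h i]`:
a cross-cut `L` of `J` from `x 0` to `x 1` with `F ⊆ L ⊆ O ∪ F ∪ {x 0, x 1}`, `L ∩ R = F` and
`L ∩ closedBall g ρw = [g - ρw, g + ρw]`. -/
theorem stub_carvedReduction_windowFrame :
    ∀ (J : JordanDomain) (g : ℂ) (ρ' h ρw : ℝ) (O L' : Set ℂ) (x : Fin 2 → ℂ),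
      0 < ρw → ρw < ρ' → 0 < h →
      {z : ℂ | |z.re - g.re| ≤ ρ' ∧ g.im - h ≤ z.im ∧ z.im ≤ g.im} ⊆ J.carrier →
      closedBall g ρw ⊆ J.carrier →
      Disjoint O {z : ℂ | |z.re - g.re| ≤ ρ' ∧ g.im - h ≤ z.im ∧ z.im ≤ g.im} →
      Disjoint O (closedBall g ρw) →
      J.IsCrosscut L' (x 0) (x 1) →
      segment ℝ (g - ρ' - h * Complex.I) (g + ρ' - h * Complex.I) ⊆ L' →
      L' ⊆ O ∪ segment ℝ (g - ρ' - h * Complex.I) (g + ρ' - h * Complex.I) ∪ {x 0, x 1} →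
      ∃ L : Set ℂ, J.IsCrosscut L (x 0) (x 1) ∧
        segment ℝ (g - ρ' - h * Complex.I) (g - ρ') ∪ segment ℝ (g - ρ') (g + ρ') ∪
            segment ℝ (g + ρ') (g + ρ' - h * Complex.I) ⊆ L ∧
        L ⊆ O ∪ (segment ℝ (g - ρ' - h * Complex.I) (g - ρ') ∪ segment ℝ (g - ρ') (g + ρ') ∪
            segment ℝ (g + ρ') (g + ρ' - h * Complex.I)) ∪ {x 0, x 1} ∧
        L ∩ {z : ℂ | |z.re - g.re| ≤ ρ' ∧ g.im - h ≤ z.im ∧ z.im ≤ g.im} =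
          segment ℝ (g - ρ' - h * Complex.I) (g - ρ') ∪ segment ℝ (g - ρ') (g + ρ') ∪
            segment ℝ (g + ρ') (g + ρ' - h * Complex.I) ∧
        L ∩ closedBall g ρw = segment ℝ (g - ρw) (g + ρw) := by
  intro J g ρ' h ρw O L' x hρw hρ' hh hRJ hBJ hOR hOB hL' hSL' hL'O
  have hρ'0 : 0 < ρ' := hρw.trans hρ'
  -- notation: rectangle, lowered diameter, frame
  set R : Set ℂ := {z : ℂ | |z.re - g.re| ≤ ρ' ∧ g.im - h ≤ z.im ∧ z.im ≤ g.im} with hR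
  set d₀ : ℂ := g - ρ' - h * Complex.I with hd₀
  set d₁ : ℂ := g + ρ' - h * Complex.I with hd₁
  set S : Set ℂ := segment ℝ d₀ d₁ with hSdef
  set F : Set ℂ := segment ℝ d₀ (g - ρ') ∪ segment ℝ (g - ρ') (g + ρ') ∪
    segment ℝ (g + ρ') d₁ with hFdef
  -- the end-points of `L'` are off `J`, hence off `R` and off the ball
  have hxJ : ∀ k, x k ∉ J.carrier := by
    intro k hk
    obtain ⟨-, hx0, hx1, -, -⟩ := hL'
    have hfr : x k ∈ frontier J.carrier := by fin_cases k <;> assumption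
    rw [J.isOpen.frontier_eq] at hfr
    exact hfr.2 hk
  -- the lowered diameter is a horizontal segment inside `R`
  have hd : g + ↑ρ' - ↑h * Complex.I = (g - ↑h * Complex.I) + ρ' := by ring
  have hd' : g - ↑ρ' - ↑h * Complex.I = (g - ↑h * Complex.I) - ρ' := by ring
  have hSR : S ⊆ R := by
    intro z hz
    rw [hSdef, hd₀, hd₁, hd, hd'] at hz
    obtain ⟨him, hre⟩ := (mem_hSegment_iff hρ'0).1 hz
    simp only [Complex.sub_re, Complex.mul_re, Complex.ofReal_re, Complex.I_re, mul_zero,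
      Complex.ofReal_im, Complex.I_im, mul_one, sub_self, sub_zero, Complex.sub_im, Complex.mul_im,
      add_zero] at him hre
    exact ⟨hre, by rw [him], by rw [him]; linarith⟩
  have hSarc : IsSimpleArc S d₀ d₁ :=
    IsSimpleArc.segment fun heq => hρ'0.ne' (by
      have := congrArg Complex.re heq
      simp [hd₀, hd₁] at this
      linarith)
  have hFarc : IsSimpleArc F d₀ d₁ := isSimpleArc_frame hρ'0 hh
  have hFR : F ⊆ R := frame_subset_rect hρ'0 hh
  have hx0S : x 0 ∉ S := fun h0 => hxJ 0 (hRJ (hSR h0))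
  have hx1S : x 1 ∉ S := fun h1 => hxJ 1 (hRJ (hSR h1))
  -- `F ∩ L' ⊆ S`
  have hFL' : F ∩ L' ⊆ S := by
    rintro z ⟨hzF, hzL⟩
    rcases hL'O hzL with (hzO | hzS) | hzx
    · exact absurd (hFR hzF) (Set.disjoint_left.1 hOR hzO)
    · exact hzS
    · exfalso
      rcases hzx with rfl | rfl
      · exact hxJ 0 (hRJ (hFR hzF))
      · exact hxJ 1 (hRJ (hFR hzF))
  refine ⟨L' \ S ∪ F, crosscut_replace J hL' hSarc hSL' hx0S hx1S hFarc hFL' (hFR.trans hRJ),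
    subset_union_right, ?_, ?_, ?_⟩
  · rintro z (⟨hzL, hzS⟩ | hzF)
    · rcases hL'O hzL with (hzO | hzS') | hzx
      · exact Or.inl (Or.inl hzO)
      · exact absurd hzS' hzS
      · exact Or.inr hzx
    · exact Or.inl (Or.inr hzF)
  · apply Subset.antisymm
    · rintro z ⟨⟨hzL, hzS⟩ | hzF, hzR⟩
      · rcases hL'O hzL with (hzO | hzS') | hzx
        · exact absurd hzR (Set.disjoint_left.1 hOR hzO)
        · exact absurd hzS' hzS
        · exfalso
          rcases hzx with rfl | rfl
          · exact hxJ 0 (hRJ hzR)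
          · exact hxJ 1 (hRJ hzR)
      · exact hzF
    · exact fun z hz => ⟨Or.inr hz, hFR hz⟩
  · apply Subset.antisymm
    · rintro z ⟨⟨hzL, hzS⟩ | hzF, hzB⟩
      · rcases hL'O hzL with (hzO | hzS') | hzx
        · exact absurd hzB (Set.disjoint_left.1 hOB hzO)
        · exact absurd hzS' hzS
        · exfalso
          rcases hzx with rfl | rfl
          · exact hxJ 0 (hBJ hzB)
          · exact hxJ 1 (hBJ hzB)
      · have : z ∈ F ∩ closedBall g ρw := ⟨hzF, hzB⟩
        rwa [hFdef, frame_inter_closedBall hρw hρ' hh] at this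
    · intro z hz
      have hz' : z ∈ F ∩ closedBall g ρw := by
        rw [hFdef, frame_inter_closedBall hρw hρ' hh]; exact hz
      exact ⟨Or.inr hz'.1, hz'.2⟩

/-! ### The closed gate box lies outside the super-domain -/

/-- **The box clause (hB)**: let `E ⊆ J ∖ C` be open with `frontier E ⊆ C ∪ ∂J` (the super-domain
cut out of `J` by the cuts `C`), flat at the gate `g` at radius `ρw`
(`E ∩ ball g ρw` = upper half-disc), and suppose the cuts meet the closed rectangle
`R = [re g ± ρ'] × [im g - h, im g] ⊆ J` exactly in the frame (`frame ⊆ C`, `C ∩ R ⊆ frame`).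
Then `R ⊆ Eᶜ`. -/
theorem superDomain_box_subset_compl {J : JordanDomain} {E C : Set ℂ} {g : ℂ} {ρ' h ρw : ℝ}
    (hρw : 0 < ρw) (hρ' : 0 < ρ') (hh : 0 < h) (hEo : IsOpen E) (hEC : E ⊆ J.carrier \ C)
    (hfr : frontier E ⊆ C ∪ frontier J.carrier)
    (hflat : E ∩ ball g ρw = {z : ℂ | g.im < z.im} ∩ ball g ρw)
    (hRJ : {z : ℂ | |z.re - g.re| ≤ ρ' ∧ g.im - h ≤ z.im ∧ z.im ≤ g.im} ⊆ J.carrier)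
    (hFC : segment ℝ (g - ρ' - h * Complex.I) (g - ρ') ∪ segment ℝ (g - ρ') (g + ρ') ∪
        segment ℝ (g + ρ') (g + ρ' - h * Complex.I) ⊆ C)
    (hCR : C ∩ {z : ℂ | |z.re - g.re| ≤ ρ' ∧ g.im - h ≤ z.im ∧ z.im ≤ g.im} ⊆
      segment ℝ (g - ρ' - h * Complex.I) (g - ρ') ∪ segment ℝ (g - ρ') (g + ρ') ∪
        segment ℝ (g + ρ') (g + ρ' - h * Complex.I)) :
    ∀ z : ℂ, |z.re - g.re| ≤ ρ' → g.im - h ≤ z.im → z.im ≤ g.im → z ∉ E := by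
  -- the open part `R'` of the rectangle (off the frame) is connected, in `J ∖ C`, and meets `Eᶜ`
  set R' : Set ℂ := {z : ℂ | |z.re - g.re| < ρ' ∧ g.im - h ≤ z.im ∧ z.im < g.im} with hR'
  have hR'conv : Convex ℝ R' := by
    have : R' = ({z : ℂ | g.re - ρ' < z.re} ∩ {z : ℂ | z.re < g.re + ρ'}) ∩
        ({z : ℂ | g.im - h ≤ z.im} ∩ {z : ℂ | z.im < g.im}) := by
      ext z
      simp only [hR', mem_setOf_eq, mem_inter_iff, abs_lt]
      constructor
      · rintro ⟨⟨h1, h2⟩, h3, h4⟩; exact ⟨⟨by linarith, by linarith⟩, h3, h4⟩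
      · rintro ⟨⟨h1, h2⟩, h3, h4⟩; exact ⟨⟨by linarith, by linarith⟩, h3, h4⟩
    rw [this]
    exact ((convex_halfSpace_re_gt _).inter (convex_halfSpace_re_lt _)).inter
      ((convex_halfSpace_im_ge _).inter (convex_halfSpace_im_lt _))
  have hR'C : Disjoint R' C := by
    refine Set.disjoint_left.2 fun z hz hzC => ?_
    have hzR : z ∈ {z : ℂ | |z.re - g.re| ≤ ρ' ∧ g.im - h ≤ z.im ∧ z.im ≤ g.im} :=
      ⟨hz.1.le, hz.2.1, hz.2.2.le⟩
    rcases hCR ⟨hzC, hzR⟩ with (hzF | hzF) | hzF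
    · rw [segment_symm] at hzF
      obtain ⟨hre, -, -⟩ := (mem_vSegment_iff hh).1 hzF
      have := hz.1
      rw [hre] at this
      simp [abs_of_pos hρ'] at this
    · obtain ⟨him, -⟩ := (mem_hSegment_iff hρ').1 hzF
      have := hz.2.2
      rw [him] at this
      exact lt_irrefl _ this
    · obtain ⟨hre, -, -⟩ := (mem_vSegment_iff hh).1 hzF
      have := hz.1
      rw [hre] at this
      simp [abs_of_pos hρ'] at this
  -- `R' ⊆ E ∪ (closure E)ᶜ`
  have hcover : R' ⊆ E ∪ (closure E)ᶜ := by
    intro z hz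
    by_cases hzE : z ∈ closure E
    · left
      by_contra hzE'
      have hzfr : z ∈ frontier E := by
        rw [frontier, hEo.interior_eq]; exact ⟨hzE, hzE'⟩
      rcases hfr hzfr with hzC | hzJ
      · exact Set.disjoint_left.1 hR'C hz hzC
      · rw [J.isOpen.frontier_eq] at hzJ
        exact hzJ.2 (hRJ ⟨hz.1.le, hz.2.1, hz.2.2.le⟩)
    · exact Or.inr hzE
  -- a witness below the gate segment
  set t : ℝ := min ρw h / 2 with ht
  have ht0 : 0 < t := by positivity
  have htw : t < ρw := by
    have := min_le_left ρw h; rw [ht]; linarith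
  have hth : t < h := by
    have := min_le_right ρw h; rw [ht]; linarith
  set w : ℂ := g - t * Complex.I with hw
  have hwre : w.re = g.re := by simp [hw]
  have hwim : w.im = g.im - t := by simp [hw]
  have hwR' : w ∈ R' := ⟨by rw [hwre]; simp [hρ'], by rw [hwim]; linarith, by rw [hwim]; linarith⟩
  have hwE : w ∉ E := by
    intro hwE
    have hwb : w ∈ ball g ρw := by
      rw [mem_ball, dist_eq_norm, hw, show g - ↑t * Complex.I - g = -(↑t * Complex.I) by ring,
        norm_neg, norm_mul, Complex.norm_real, Complex.norm_I, mul_one, Real.norm_of_nonneg ht0.le]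
      exact htw
    have : w ∈ E ∩ ball g ρw := ⟨hwE, hwb⟩
    rw [hflat] at this
    have h1 : g.im < w.im := this.1
    rw [hwim] at h1
    linarith
  have hR'E : R' ⊆ (closure E)ᶜ := by
    rcases hR'conv.isPreconnected.subset_or_subset hEo isClosed_closure.isOpen_compl
        (Set.disjoint_left.2 fun z hz hz' => hz' (subset_closure hz)) hcover with h1 | h1
    · exact absurd (h1 hwR') hwE
    · exact h1
  -- conclusion: a point of the rectangle is in `R'` or on the frame
  intro z hre him1 him2 hzE
  by_cases hz : |z.re - g.re| < ρ' ∧ z.im < g.im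
  · exact hR'E ⟨hz.1, him1, hz.2⟩ (subset_closure hzE)
  · have hzC : z ∈ C := by
      apply hFC
      rw [not_and_or, not_lt, not_lt] at hz
      rcases hz with hz | hz
      · -- on a vertical side
        have habs : |z.re - g.re| = ρ' := le_antisymm hre hz
        rcases (abs_eq hρ'.le).1 habs with h1 | h1
        · right
          refine (mem_vSegment_iff hh).2 ⟨?_, ?_, ?_⟩
          · simp; linarith
          · simp; linarith
          · simpa using him2
        · left; left
          rw [segment_symm]
          refine (mem_vSegment_iff hh).2 ⟨?_, ?_, ?_⟩
          · simp; linarith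
          · simp; linarith
          · simpa using him2
      · -- on the top edge
        left; right
        exact (mem_hSegment_iff hρ').2 ⟨le_antisymm him2 hz, hre⟩
    exact (hEC hzE).2 hzC

end Summit.CriticalPhenomena.SAWScalingLimit.Theorems.ObservableToSLE.TypeLadder

end
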